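import Summits.MatrixMultiplication.OmegaCensus.SmallFormats.MatMul22nRankGF7PatternComplete
import Summits.MatrixMultiplication.OmegaCensus.SmallFormats.MatMul22nRankGF7Normalise
import Summits.MatrixMultiplication.OmegaCensus.SmallFormats.MatMul22nRankGF7TightGeneral
import HarnessLib

/-!
# ω-census family (a): WLOG for the slack-4 `𝔽₇` X-cap system — the torus-0 column may be taken to be a class representative

Cell `pub-omega` (unit `pub-omega-tensor-g15`), topic `Summits/MatrixMultiplication/OmegaCensus` (sub-folder `SmallFormats`).
Framing (verbatim): lottery ticket; floor = certified bounds/negative ranges. HONEST FRAMING: kernel infrastructure, the WLOG step of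
`pub-omega-tensor-g15/KERNEL-S4-DESIGN.md` assembled from its landed parts; nothing here is progress on `ω`.

`slack4_wlog7`: if `x` is a point of the 1274 rows of `xcapSys7s 4` in the box `[0,4]` with total `≥ 208` (an LP-tight point), then for some
generator word `W` and some class `c < 120` the relabelled point `xLmulW7 W x` is again such a point and its torus-`0` column IS the class
representative `repVal7 c`; moreover (`slack4_tight_cols7`) all torus columns of such a point are slack-4 patterns. So a refutation of
`NoTightPoint7 4 208` may assume the torus-`0` column is one of the 120 representatives (`noTightPoint7_4_208_of_reps`).
-/

namespace Summit.MatrixMultiplication.OmegaCensus.SmallFormats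

open Finset

/-- At an LP-tight point of slack `4`, every torus column is a slack-4 pattern (as a function on `Ω`). -/
theorem slack4_tight_cols7 (x : ℕ → ℕ) (hrows : ∀ r < 1274, capRowVal7 x r ≤ rhs7s 4 r)
    (hge : (208 : ℤ) ≤ ∑ j ∈ range 401, (x j : ℤ)) {j : ℕ} (hj : j < 21) : IsPat7 4 (colN7 x j) := by
  obtain ⟨_, hT, hR, hP, _⟩ := tight7_of_total_ge 4 x hrows (by push_cast; linarith)
  refine ⟨fun z hz => ?_, fun y hy b hb => ?_⟩
  · have h := col_le7 4 x (fun r h1 h2 => by exact_mod_cast hP r h1 h2) hj hz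
    have e := colN7_cast x j z
    have : ((colN7 x j z : ℕ) : ℤ) ≤ 4 := by rw [e]; exact_mod_cast h
    exact_mod_cast this
  · have h := col_hept_sum7 4 x (fun r hr => by exact_mod_cast hT r hr) (fun k hk => by exact_mod_cast hR k hk) hj hy hb
    have e : ((∑ i ∈ range 7, colN7 x j (heptPt7 y b i) : ℕ) : ℤ) = ∑ i ∈ range 7, xrs7 x (cosetRow7 j (heptPt7 y b i)) := by
      push_cast; exact sum_congr rfl fun i _ => colN7_cast x j _
    have : ((∑ i ∈ range 7, colN7 x j (heptPt7 y b i) : ℕ) : ℤ) = ((6 * 4 : ℕ) : ℤ) := by rw [e, h]; norm_num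
    exact_mod_cast this

/-- **WLOG.** An LP-tight point of slack `4` can be relabelled (by left multiplication) into an LP-tight point whose torus-`0` column is
one of the 120 class representatives. -/
theorem slack4_wlog7 (x : ℕ → ℕ) (hbox : ∀ j, x j ≤ 4) (hrows : ∀ r < 1274, capRowVal7 x r ≤ rhs7s 4 r)
    (hge : (208 : ℤ) ≤ ∑ j ∈ range 401, (x j : ℤ)) :
    ∃ W : List ℕ, ∃ c < 120, (∀ k ∈ W, k < 2) ∧ (∀ j, xLmulW7 W x j ≤ 4) ∧
      (∀ r < 1274, capRowVal7 (xLmulW7 W x) r ≤ rhs7s 4 r) ∧ (208 : ℤ) ≤ ∑ j ∈ range 401, (xLmulW7 W x j : ℤ) ∧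
      ∀ z < 42, colN7 (xLmulW7 W x) 0 z = repVal7 c z := by
  -- normalise
  obtain ⟨W₁, hW₁, hN⟩ := exists_norm_word7 x hbox hrows
  obtain ⟨hb1, hr1, ht1, _⟩ := lmulW7_spec W₁ hW₁ x hbox hrows
  have hge1 : (208 : ℤ) ≤ ∑ j ∈ range 401, (xLmulW7 W₁ x j : ℤ) := by rw [ht1]; exact hge
  have hpat : IsPat7 4 (colN7 (xLmulW7 W₁ x) 0) := slack4_tight_cols7 _ hr1 hge1 (by norm_num)
  -- the normalised column is a representative moved by a word
  obtain ⟨c, hc, w, hw, hval⟩ := norm_pattern_rep7 hpat hN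
  -- undo the word
  have hcol := col_eq_of_rep7 (xLmulW7 W₁ x) hb1 hr1 hw (repVal7 c) hval
  obtain ⟨hb2, hr2, ht2, _⟩ := lmulW7_spec (invWord7 w) (invWord7_letters hw) (xLmulW7 W₁ x) hb1 hr1
  refine ⟨W₁ ++ invWord7 w, c, hc, ?_, ?_, ?_, ?_, ?_⟩
  · intro k hk; rw [List.mem_append] at hk
    rcases hk with hk | hk
    · exact hW₁ k hk
    · exact invWord7_letters hw k hk
  · rw [xLmulW7_append]; exact hb2
  · rw [xLmulW7_append]; exact hr2
  · rw [xLmulW7_append, ht2]; exact hge1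
  · rw [xLmulW7_append]; exact hcol

/-- **Reduction of `NoTightPoint7 4 208` to the 120 representative cases.** If no LP-tight point of slack `4` has a representative as its
torus-`0` column, there is no LP-tight point at all. -/
theorem noTightPoint7_4_208_of_reps
    (H : ∀ c < 120, ∀ x : ℕ → ℕ, (∀ j, x j ≤ 4) → (∀ r < 1274, capRowVal7 x r ≤ rhs7s 4 r) →
      (208 : ℤ) ≤ ∑ j ∈ range 401, (x j : ℤ) → (∀ z < 42, colN7 x 0 z = repVal7 c z) → False) :
    NoTightPoint7 4 208 := by
  intro x hbox hrows
  by_contra hlt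
  have hge : (208 : ℤ) ≤ ∑ j ∈ range 401, (x j : ℤ) := by push_cast at hlt ⊢; linarith
  obtain ⟨W, c, hc, _, hb, hr, hg, hcol⟩ := slack4_wlog7 x hbox hrows hge
  exact H c hc _ hb hr hg hcol

end Summit.MatrixMultiplication.OmegaCensus.SmallFormats
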